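import Summits.CriticalPhenomena.PercolationContinuityZ3.Theorems.Transplant.SkelFrmBParamsCorr
import Summits.CriticalPhenomena.PercolationContinuityZ3.Theorems.Transplant.SkelNegBParamsCorr
import Summits.CriticalPhenomena.PercolationContinuityZ3.Theorems.Transplant.SkelFrmBParamsLFA
import Summits.CriticalPhenomena.PercolationContinuityZ3.Theorems.Transplant.SkelNegBParamsLFA
import Summits.CriticalPhenomena.PercolationContinuityZ3.Theorems.Transplant.SkelNegBParamsCorrA
import Summits.CriticalPhenomena.PercolationContinuityZ3.Theorems.Transplant.PlanarSkeletonFrmDefs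
import Summits.CriticalPhenomena.PercolationContinuityZ3.Theorems.Transplant.SkelPhiStepIDataNS
import HarnessLib

/-!
# N2 (frames-only node `SamePDropOfSkeletonFrm₁`, OPEN) params column over `PlanarSkeletonFrm` — (ζ″) ledger, shape (B′) of record ((R-14)):
# MECHANICAL PORT of N1's `SkelNegBParamsCorrA` — chain of record `NegB`, part Corr-A — the (ζ′) twin of part Corr (p28xxxx) at `A := Aof κ = 20·K` ((C) column): THE
# PHASE-1 LOCALISATION RECORD OF RECORD **`NegB.locPrm₁A κ Φ t p D g f : ChainPara.LocPrm`** — the signed v-rounds over the fine cell map `fineA` of the (ζ′) cells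
# `fcellsA` (p5-g8 … (N1 title abridged; see `SkelNegBParamsCorrA`)
builds on p205010 (kernel theorem, internal audit signed; external expert review pending) — nothing in this file uses p205010; NOTHING is claimed about the
open node `SamePDropOfSkeletonFrm₁` (`SamePDropOfSkeletonNeg₁` is CLOSED in the tree and untouched by this file).
Status sentence (coordinator 2026-08-20T04:30Z): "θ(p_c) = 0 on ℤ^d, all d ≥ 2 — kernel-verified (Lean 4/Mathlib, standard axioms); internal adversarial
audit SIGNED 2026-08-20 04:29Z; external expert review pending."
Lane `prim-bschramm-*`, seat `prim-bschramm-stmt` (gen 19); helper file (`--supports stmt-CriticalPhenomena-4575 --as helper`); ledger HOME/prim-bschramm-stmt/FRM-PARAMS.md §9, (R-14).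
PORT RULES (HOME/prim-bschramm-stmt-g19/lean/port_frm.py, the tool of record per (R-14)): outer namespace `PlanarSkeletonNeg ↦ PlanarSkeletonFrm`, carrier binder
`(Φ : PlanarSkeletonFrm G)`, record binder `(D : Skelφ.StepI.DataNS V)` (the selectors travel IN the record, `SkelPhiStepIDataNS`); section variables INLINED into every
declaration header; inner namespaces (`Neg`/`NegB`/`KS`/…) and every short name KEPT so all cross-references resolve unchanged; declarations using no section variable are
NOT re-declared (N1's originals are referenced fully qualified). Mathematical content, proofs, docstrings and citations are N1's, verbatim, except where stated next.
SELECTORS IN THIS FILE ((R-14) condition of record — joint selection, `D.sN`'s first argument is the literal handed to `D.sM`): none (pure port; the pairs are read through their N1 names).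
N1 HEADER (kept for the reader):
helper file (`--supports stmt-CriticalPhenomena-4575 --as helper`); ledger HOME/prim-bschramm-stmt/NEG-PARAMS.md.
* §1 `c0A/c1A/DdA`, **`TrdA`**, `aHiA/aLoA/sHiCA/sLoCA/PpCA/PmCA/zCA/eCA/LaCA/LbCA/WCA/L0CA/NCA`, **`locPrm₁A`**; §2 `locPrm₁A_fields`, `DdA_pos`, `cA_nonneg'`, the fifteen hypotheses by name
  (`hsHiA_at … hzMA_at`, `eA_sub_z`, `h3r₀A_at`, `L0A_eq`, `hLaA_at`, `hLbA_at`); §3 `aLoA_le_aHiA`, `locOKA_hs/hsL/hP`, **`locOKA_of`**, **`hNA_at`**.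
[cite: KozmaNitzan2024, §4 Lemma 11 (pp. 22–23), Lemma 12 (pp. 23–25)] [cite: MartineauTassion2017, §4.3 Lemma 4.2]
-/

noncomputable section

open scoped Classical

namespace Summit.CriticalPhenomena.PercolationContinuityZ3.Theorems.Transplant

namespace PlanarSkeletonFrm

namespace NegB

open Literature.Probability.Percolation Literature.Probability.LatticeModels SimpleGraph
open SkelConc (Consts)
open Neg
open TwoAxis.Para (modulus)

section CorrLevel

/-! ## §1 The reading terms and the record -/

/-- The resolution of axis `0`: `c₀ := 20·K·(m₀ − 1)` (`fcells`). [this work] -/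
def c0A (κ : Consts) {V : Type} [DecidableEq V] [Countable V] {G : SimpleGraph V} [G.LocallyFinite] (Φ : PlanarSkeletonFrm G) (t : V) (p : unitInterval) (D : Skelφ.StepI.DataNS V) (g : ℕ) (f : ℕ) : ℤ := 20 * ((fcellsA κ Φ t p D g f).K : ℤ) * (((fcellsA κ Φ t p D g f).s 0 : ℕ) : ℤ)

/-- The resolution of axis `1`: `c₁ := 20·K·(m₁ − 1)` (`fcells`). [this work] -/
def c1A (κ : Consts) {V : Type} [DecidableEq V] [Countable V] {G : SimpleGraph V} [G.LocallyFinite] (Φ : PlanarSkeletonFrm G) (t : V) (p : unitInterval) (D : Skelφ.StepI.DataNS V) (g : ℕ) (f : ℕ) : ℤ := 20 * ((fcellsA κ Φ t p D g f).K : ℤ) * (((fcellsA κ Φ t p D g f).s 1 : ℕ) : ℤ)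

/-- The determinant `D := Dof n_L h_L ℓ_L v_L`. [this work] -/
def DdA (κ : Consts) {V : Type} [DecidableEq V] [Countable V] {G : SimpleGraph V} [G.LocallyFinite] (Φ : PlanarSkeletonFrm G) (t : V) (p : unitInterval) (D : Skelφ.StepI.DataNS V) (g : ℕ) (f : ℕ) : ℤ := Skelφ.NegPrm.DofA (Aof κ) (nL κ Φ t p D g f) (hL κ Φ t p D g f) (ℓL κ Φ t p D g f) (vL κ Φ t p D g f)

/-- **The transverse reading term** `TrdA x B := ⌊c₀·(A·(m·x − B)/n)/D_A⌋` (the shape of (C-N3)'s `coarseSkel_zero_sub_bounds_signed`). [this work] -/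
def TrdA (κ : Consts) {V : Type} [DecidableEq V] [Countable V] {G : SimpleGraph V} [G.LocallyFinite] (Φ : PlanarSkeletonFrm G) (t : V) (p : unitInterval) (D : Skelφ.StepI.DataNS V) (g : ℕ) (f : ℕ) (x B : ℤ) : ℤ := (c0A κ Φ t p D g f * (Aof κ * (md κ Φ t p D g f * x - B) / (nL κ Φ t p D g f : ℤ))) / DdA κ Φ t p D g f

/-- The along reading of the far edge `⌊c₁·A·β_hi/D_A⌋`. [this work] -/
def aHiA (κ : Consts) {V : Type} [DecidableEq V] [Countable V] {G : SimpleGraph V} [G.LocallyFinite] (Φ : PlanarSkeletonFrm G) (t : V) (p : unitInterval) (D : Skelφ.StepI.DataNS V) (g : ℕ) (f : ℕ) : ℤ := (c1A κ Φ t p D g f * (Aof κ * βhi κ Φ t p D g f)) / DdA κ Φ t p D g f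

/-- The along reading of the near edge `⌊c₁·A·β_lo/D_A⌋`. [this work] -/
def aLoA (κ : Consts) {V : Type} [DecidableEq V] [Countable V] {G : SimpleGraph V} [G.LocallyFinite] (Φ : PlanarSkeletonFrm G) (t : V) (p : unitInterval) (D : Skelφ.StepI.DataNS V) (g : ℕ) (f : ℕ) : ℤ := (c1A κ Φ t p D g f * (Aof κ * βlo κ Φ t p D g f)) / DdA κ Φ t p D g f

/-- `max (−L·s_lo) …`: the maximal along progress `sHi := aHiA + 1`. [this work] -/
def sHiCA (κ : Consts) {V : Type} [DecidableEq V] [Countable V] {G : SimpleGraph V} [G.LocallyFinite] (Φ : PlanarSkeletonFrm G) (t : V) (p : unitInterval) (D : Skelφ.StepI.DataNS V) (g : ℕ) (f : ℕ) : ℤ := aHiA κ Φ t p D g f + 1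

/-- The minimal along progress `sLo := aLoA − 1`. [this work] -/
def sLoCA (κ : Consts) {V : Type} [DecidableEq V] [Countable V] {G : SimpleGraph V} [G.LocallyFinite] (Φ : PlanarSkeletonFrm G) (t : V) (p : unitInterval) (D : Skelφ.StepI.DataNS V) (g : ℕ) (f : ℕ) : ℤ := aLoA κ Φ t p D g f - 1

/-- The `τ = +1` piece length `Pp := max (TrdA n Bmin + 1) (−TrdA (−n) Bmax′)` (as a natural). [this work] -/
def PpCA (κ : Consts) {V : Type} [DecidableEq V] [Countable V] {G : SimpleGraph V} [G.LocallyFinite] (Φ : PlanarSkeletonFrm G) (t : V) (p : unitInterval) (D : Skelφ.StepI.DataNS V) (g : ℕ) (f : ℕ) : ℕ := (max (TrdA κ Φ t p D g f (nL κ Φ t p D g f) (Bmin κ Φ t p D g f) + 1) (-TrdA κ Φ t p D g f (-(nL κ Φ t p D g f : ℤ)) (Bmax' κ Φ t p D g f))).toNat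

/-- The `τ = −1` piece length `Pm := max (−TrdA (−n) Bmax) (TrdA n Bmin′ + 1)`. [this work] -/
def PmCA (κ : Consts) {V : Type} [DecidableEq V] [Countable V] {G : SimpleGraph V} [G.LocallyFinite] (Φ : PlanarSkeletonFrm G) (t : V) (p : unitInterval) (D : Skelφ.StepI.DataNS V) (g : ℕ) (f : ℕ) : ℕ := (max (-TrdA κ Φ t p D g f (-(nL κ Φ t p D g f : ℤ)) (Bmax κ Φ t p D g f)) (TrdA κ Φ t p D g f (nL κ Φ t p D g f) (Bmin' κ Φ t p D g f) + 1)).toNat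

/-- **The floor slack of the readings** `z := max {TrdA v Bmin + 1, TrdA (−v) Bmin′ + 1, −TrdA v Bmax, −TrdA (−v) Bmax′}` (O(1): at the split point `v = v_α` the numerators cancel to
`v_α·(m − nℓ)`-type terms). [this work] -/
def zCA (κ : Consts) {V : Type} [DecidableEq V] [Countable V] {G : SimpleGraph V} [G.LocallyFinite] (Φ : PlanarSkeletonFrm G) (t : V) (p : unitInterval) (D : Skelφ.StepI.DataNS V) (g : ℕ) (f : ℕ) : ℕ :=
  (max (max (TrdA κ Φ t p D g f (vL κ Φ t p D g f) (Bmin κ Φ t p D g f) + 1) (TrdA κ Φ t p D g f (-vL κ Φ t p D g f) (Bmin' κ Φ t p D g f) + 1))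
    (max (-TrdA κ Φ t p D g f (vL κ Φ t p D g f) (Bmax κ Φ t p D g f)) (-TrdA κ Φ t p D g f (-vL κ Φ t p D g f) (Bmax' κ Φ t p D g f)))).toNat

/-- **The siting slack per round** `e := z + R′` (reading slack + kit level depth; the schedule's enlargement is `R′ = e − z`, p5-g8 15:15:39Z (2)). [this work] -/
def eCA (κ : Consts) {V : Type} [DecidableEq V] [Countable V] {G : SimpleGraph V} [G.LocallyFinite] (Φ : PlanarSkeletonFrm G) (t : V) (p : unitInterval) (D : Skelφ.StepI.DataNS V) (g : ℕ) (f : ℕ) : ℕ := zCA κ Φ t p D g f + R' κ Φ t p D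

/-- The along half-size of the link box `La := max sHi (⌊c₁·A·3β_hi/D_A⌋ + 1)`. [this work] -/
def LaCA (κ : Consts) {V : Type} [DecidableEq V] [Countable V] {G : SimpleGraph V} [G.LocallyFinite] (Φ : PlanarSkeletonFrm G) (t : V) (p : unitInterval) (D : Skelφ.StepI.DataNS V) (g : ℕ) (f : ℕ) : ℕ := (max (sHiCA κ Φ t p D g f) ((c1A κ Φ t p D g f * (Aof κ * (3 * βhi κ Φ t p D g f))) / DdA κ Φ t p D g f + 1)).toNat

/-- The transverse half-size of the link box `Lb := ⌊c₀·A·(|m|·n + |vα|·3β_hi)/(n·D_A)⌋ + 1`. [this work] -/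
def LbCA (κ : Consts) {V : Type} [DecidableEq V] [Countable V] {G : SimpleGraph V} [G.LocallyFinite] (Φ : PlanarSkeletonFrm G) (t : V) (p : unitInterval) (D : Skelφ.StepI.DataNS V) (g : ℕ) (f : ℕ) : ℕ :=
  ((c0A κ Φ t p D g f * (Aof κ * (|md κ Φ t p D g f| * nL κ Φ t p D g f + |vL κ Φ t p D g f| * (3 * βhi κ Φ t p D g f)))) / ((nL κ Φ t p D g f : ℤ) * DdA κ Φ t p D g f) + 1).toNat

/-- The transverse half-window `W := max (3·r₀) (max Pp Pm + z)` (arrival box `M ⊆ core 0`, p5-g8 15:15:39Z (3)). [this work] -/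
def WCA (κ : Consts) {V : Type} [DecidableEq V] [Countable V] {G : SimpleGraph V} [G.LocallyFinite] (Φ : PlanarSkeletonFrm G) (t : V) (p : unitInterval) (D : Skelφ.StepI.DataNS V) (g : ℕ) (f : ℕ) : ℕ := max (3 * (fcellsA κ Φ t p D g f).r 0) (max (PpCA κ Φ t p D g f) (PmCA κ Φ t p D g f) + zCA κ Φ t p D g f)

/-- The along half-width of core `0`: `L0 := 3·r₁`. [this work] -/
def L0CA (κ : Consts) {V : Type} [DecidableEq V] [Countable V] {G : SimpleGraph V} [G.LocallyFinite] (Φ : PlanarSkeletonFrm G) (t : V) (p : unitInterval) (D : Skelφ.StepI.DataNS V) (g : ℕ) (f : ℕ) : ℕ := 3 * (fcellsA κ Φ t p D g f).r 1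

/-- **The number of rounds** `N := ⌊(3r₁ − sHi)/(sLo − e)⌋₊ + 1` (so that `L0 ≤ sHi + (N+1)(sLo − e)` once `sLo > e`, p5-g8 15:15:39Z (4)). [this work] -/
def NCA (κ : Consts) {V : Type} [DecidableEq V] [Countable V] {G : SimpleGraph V} [G.LocallyFinite] (Φ : PlanarSkeletonFrm G) (t : V) (p : unitInterval) (D : Skelφ.StepI.DataNS V) (g : ℕ) (f : ℕ) : ℕ := (((L0CA κ Φ t p D g f : ℤ) - sHiCA κ Φ t p D g f) / (sLoCA κ Φ t p D g f - eCA κ Φ t p D g f)).toNat + 1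

/-- **THE PHASE-1 LOCALISATION RECORD OF RECORD** (signed v-rounds over the fine cell map, cell axis `1`). [cite: KozmaNitzan2024, §4 Lemma 12 (pp. 23–25)] -/
def locPrm₁A (κ : Consts) {V : Type} [DecidableEq V] [Countable V] {G : SimpleGraph V} [G.LocallyFinite] (Φ : PlanarSkeletonFrm G) (t : V) (p : unitInterval) (D : Skelφ.StepI.DataNS V) (g : ℕ) (f : ℕ) : ChainPara.LocPrm :=
  ⟨sLoCA κ Φ t p D g f, sHiCA κ Φ t p D g f, PpCA κ Φ t p D g f, PmCA κ Φ t p D g f, WCA κ Φ t p D g f, eCA κ Φ t p D g f, LaCA κ Φ t p D g f, LbCA κ Φ t p D g f,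
    L0CA κ Φ t p D g f, NCA κ Φ t p D g f⟩

/-! ## §2 The fifteen hypotheses of (C-N8) by name -/

/-- The record's fields, unfolded. [folklore] -/
theorem locPrm₁A_fields (κ : Consts) {V : Type} [DecidableEq V] [Countable V] {G : SimpleGraph V} [G.LocallyFinite] (Φ : PlanarSkeletonFrm G) (t : V) (p : unitInterval) (D : Skelφ.StepI.DataNS V) (g : ℕ) (f : ℕ) :
    (locPrm₁A κ Φ t p D g f).sLo = sLoCA κ Φ t p D g f ∧ (locPrm₁A κ Φ t p D g f).sHi = sHiCA κ Φ t p D g f ∧ (locPrm₁A κ Φ t p D g f).Pp = PpCA κ Φ t p D g f ∧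
      (locPrm₁A κ Φ t p D g f).Pm = PmCA κ Φ t p D g f ∧ (locPrm₁A κ Φ t p D g f).W = WCA κ Φ t p D g f ∧ (locPrm₁A κ Φ t p D g f).e = eCA κ Φ t p D g f ∧
      (locPrm₁A κ Φ t p D g f).La = LaCA κ Φ t p D g f ∧ (locPrm₁A κ Φ t p D g f).Lb = LbCA κ Φ t p D g f ∧ (locPrm₁A κ Φ t p D g f).L0 = L0CA κ Φ t p D g f ∧
      (locPrm₁A κ Φ t p D g f).N = NCA κ Φ t p D g f :=
  ⟨rfl, rfl, rfl, rfl, rfl, rfl, rfl, rfl, rfl, rfl⟩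

/-- `D > 0` under the numeric long clause. [folklore] -/
theorem DdA_pos (κ : Consts) {V : Type} [DecidableEq V] [Countable V] {G : SimpleGraph V} [G.LocallyFinite] (Φ : PlanarSkeletonFrm G) (t : V) (p : unitInterval) (D : Skelφ.StepI.DataNS V) (g : ℕ) (f : ℕ) (hN : EqNumL κ Φ t p D g f) : 0 < DdA κ Φ t p D g f := by
  obtain ⟨hn1, hℓ1⟩ := one_le_of_eqNumL κ Φ t p D g f hN
  exact Skelφ.NegPrm.DofA_pos (Aof_pos κ).2 hn1 hℓ1 _ _

/-- `0 ≤ c₀` and `0 ≤ c₁`. [folklore] -/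
theorem cA_nonneg' (κ : Consts) {V : Type} [DecidableEq V] [Countable V] {G : SimpleGraph V} [G.LocallyFinite] (Φ : PlanarSkeletonFrm G) (t : V) (p : unitInterval) (D : Skelφ.StepI.DataNS V) (g : ℕ) (f : ℕ) : 0 ≤ c0A κ Φ t p D g f ∧ 0 ≤ c1A κ Φ t p D g f := by unfold c0A c1A; constructor <;> positivity

/-- **`hsHi`**: `⌊c₁·(A·nℓ)/D⌋ + 1 ≤ sHi` (equality). [folklore] -/
theorem hsHiA_at (κ : Consts) {V : Type} [DecidableEq V] [Countable V] {G : SimpleGraph V} [G.LocallyFinite] (Φ : PlanarSkeletonFrm G) (t : V) (p : unitInterval) (D : Skelφ.StepI.DataNS V) (g : ℕ) (f : ℕ) : (c1A κ Φ t p D g f * (Aof κ * ((nL κ Φ t p D g f : ℤ) * ℓL κ Φ t p D g f))) / DdA κ Φ t p D g f + 1 ≤ (locPrm₁A κ Φ t p D g f).sHi := le_rfl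

/-- **`hsLo`**: `sLo + 1 ≤ ⌊c₁·(A·(nℓ − (n+|h|) + 1))/D⌋` (equality). [folklore] -/
theorem hsLoA_at (κ : Consts) {V : Type} [DecidableEq V] [Countable V] {G : SimpleGraph V} [G.LocallyFinite] (Φ : PlanarSkeletonFrm G) (t : V) (p : unitInterval) (D : Skelφ.StepI.DataNS V) (g : ℕ) (f : ℕ) : (locPrm₁A κ Φ t p D g f).sLo + 1 ≤
    (c1A κ Φ t p D g f * (Aof κ * ((nL κ Φ t p D g f : ℤ) * ℓL κ Φ t p D g f - (nL κ Φ t p D g f + (hL κ Φ t p D g f).natAbs : ℕ) + 1))) / DdA κ Φ t p D g f := by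
  show sLoCA κ Φ t p D g f + 1 ≤ _
  unfold sLoCA aLoA βlo
  omega

/-- **`hp₁`**: `TrdA n Bmin + 1 ≤ Pp`. [folklore] -/
theorem hp₁A_at (κ : Consts) {V : Type} [DecidableEq V] [Countable V] {G : SimpleGraph V} [G.LocallyFinite] (Φ : PlanarSkeletonFrm G) (t : V) (p : unitInterval) (D : Skelφ.StepI.DataNS V) (g : ℕ) (f : ℕ) : TrdA κ Φ t p D g f (nL κ Φ t p D g f) (Bmin κ Φ t p D g f) + 1 ≤ ((locPrm₁A κ Φ t p D g f).Pp : ℤ) := by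
  show _ ≤ ((PpCA κ Φ t p D g f : ℕ) : ℤ)
  unfold PpCA
  exact (le_max_left _ _).trans (Int.self_le_toNat _)

/-- **`hp₂`**: `−Pp ≤ TrdA (−n) Bmax′`. [folklore] -/
theorem hp₂A_at (κ : Consts) {V : Type} [DecidableEq V] [Countable V] {G : SimpleGraph V} [G.LocallyFinite] (Φ : PlanarSkeletonFrm G) (t : V) (p : unitInterval) (D : Skelφ.StepI.DataNS V) (g : ℕ) (f : ℕ) : -((locPrm₁A κ Φ t p D g f).Pp : ℤ) ≤ TrdA κ Φ t p D g f (-(nL κ Φ t p D g f : ℤ)) (Bmax' κ Φ t p D g f) := by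
  show -((PpCA κ Φ t p D g f : ℕ) : ℤ) ≤ _
  unfold PpCA
  have := (le_max_right (TrdA κ Φ t p D g f (nL κ Φ t p D g f) (Bmin κ Φ t p D g f) + 1) _).trans
    (Int.self_le_toNat (max (TrdA κ Φ t p D g f (nL κ Φ t p D g f) (Bmin κ Φ t p D g f) + 1) (-TrdA κ Φ t p D g f (-(nL κ Φ t p D g f : ℤ)) (Bmax' κ Φ t p D g f))))
  linarith

/-- **`hm₁`**: `−Pm ≤ TrdA (−n) Bmax`. [folklore] -/
theorem hm₁A_at (κ : Consts) {V : Type} [DecidableEq V] [Countable V] {G : SimpleGraph V} [G.LocallyFinite] (Φ : PlanarSkeletonFrm G) (t : V) (p : unitInterval) (D : Skelφ.StepI.DataNS V) (g : ℕ) (f : ℕ) : -((locPrm₁A κ Φ t p D g f).Pm : ℤ) ≤ TrdA κ Φ t p D g f (-(nL κ Φ t p D g f : ℤ)) (Bmax κ Φ t p D g f) := by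
  show -((PmCA κ Φ t p D g f : ℕ) : ℤ) ≤ _
  unfold PmCA
  have := (le_max_left (-TrdA κ Φ t p D g f (-(nL κ Φ t p D g f : ℤ)) (Bmax κ Φ t p D g f)) _).trans
    (Int.self_le_toNat (max (-TrdA κ Φ t p D g f (-(nL κ Φ t p D g f : ℤ)) (Bmax κ Φ t p D g f)) (TrdA κ Φ t p D g f (nL κ Φ t p D g f) (Bmin' κ Φ t p D g f) + 1)))
  linarith

/-- **`hm₂`**: `TrdA n Bmin′ + 1 ≤ Pm`. [folklore] -/
theorem hm₂A_at (κ : Consts) {V : Type} [DecidableEq V] [Countable V] {G : SimpleGraph V} [G.LocallyFinite] (Φ : PlanarSkeletonFrm G) (t : V) (p : unitInterval) (D : Skelφ.StepI.DataNS V) (g : ℕ) (f : ℕ) : TrdA κ Φ t p D g f (nL κ Φ t p D g f) (Bmin' κ Φ t p D g f) + 1 ≤ ((locPrm₁A κ Φ t p D g f).Pm : ℤ) := by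
  show _ ≤ ((PmCA κ Φ t p D g f : ℕ) : ℤ)
  unfold PmCA
  exact (le_max_right _ _).trans (Int.self_le_toNat _)

/-- **`hz₂`**: `TrdA v Bmin + 1 ≤ z`. [folklore] -/
theorem hz₂A_at (κ : Consts) {V : Type} [DecidableEq V] [Countable V] {G : SimpleGraph V} [G.LocallyFinite] (Φ : PlanarSkeletonFrm G) (t : V) (p : unitInterval) (D : Skelφ.StepI.DataNS V) (g : ℕ) (f : ℕ) : TrdA κ Φ t p D g f (vL κ Φ t p D g f) (Bmin κ Φ t p D g f) + 1 ≤ (zCA κ Φ t p D g f : ℤ) := by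
  unfold zCA
  exact ((le_max_left _ _).trans (le_max_left _ _)).trans (Int.self_le_toNat _)

/-- **`hz₃`**: `TrdA (−v) Bmin′ + 1 ≤ z`. [folklore] -/
theorem hz₃A_at (κ : Consts) {V : Type} [DecidableEq V] [Countable V] {G : SimpleGraph V} [G.LocallyFinite] (Φ : PlanarSkeletonFrm G) (t : V) (p : unitInterval) (D : Skelφ.StepI.DataNS V) (g : ℕ) (f : ℕ) : TrdA κ Φ t p D g f (-vL κ Φ t p D g f) (Bmin' κ Φ t p D g f) + 1 ≤ (zCA κ Φ t p D g f : ℤ) := by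
  unfold zCA
  exact ((le_max_right _ _).trans (le_max_left _ _)).trans (Int.self_le_toNat _)

/-- **`hz₁`**: `−z ≤ TrdA v Bmax`. [folklore] -/
theorem hz₁A_at (κ : Consts) {V : Type} [DecidableEq V] [Countable V] {G : SimpleGraph V} [G.LocallyFinite] (Φ : PlanarSkeletonFrm G) (t : V) (p : unitInterval) (D : Skelφ.StepI.DataNS V) (g : ℕ) (f : ℕ) : -(zCA κ Φ t p D g f : ℤ) ≤ TrdA κ Φ t p D g f (vL κ Φ t p D g f) (Bmax κ Φ t p D g f) := by
  unfold zCA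
  have := ((le_max_left (-TrdA κ Φ t p D g f (vL κ Φ t p D g f) (Bmax κ Φ t p D g f)) _).trans (le_max_right _ _)).trans
    (Int.self_le_toNat (max (max (TrdA κ Φ t p D g f (vL κ Φ t p D g f) (Bmin κ Φ t p D g f) + 1) (TrdA κ Φ t p D g f (-vL κ Φ t p D g f) (Bmin' κ Φ t p D g f) + 1))
      (max (-TrdA κ Φ t p D g f (vL κ Φ t p D g f) (Bmax κ Φ t p D g f)) (-TrdA κ Φ t p D g f (-vL κ Φ t p D g f) (Bmax' κ Φ t p D g f)))))
  linarith

/-- **`hz₄`**: `−z ≤ TrdA (−v) Bmax′`. [folklore] -/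
theorem hz₄A_at (κ : Consts) {V : Type} [DecidableEq V] [Countable V] {G : SimpleGraph V} [G.LocallyFinite] (Φ : PlanarSkeletonFrm G) (t : V) (p : unitInterval) (D : Skelφ.StepI.DataNS V) (g : ℕ) (f : ℕ) : -(zCA κ Φ t p D g f : ℤ) ≤ TrdA κ Φ t p D g f (-vL κ Φ t p D g f) (Bmax' κ Φ t p D g f) := by
  unfold zCA
  have := ((le_max_right _ (-TrdA κ Φ t p D g f (-vL κ Φ t p D g f) (Bmax' κ Φ t p D g f))).trans (le_max_right _ _)).trans
    (Int.self_le_toNat (max (max (TrdA κ Φ t p D g f (vL κ Φ t p D g f) (Bmin κ Φ t p D g f) + 1) (TrdA κ Φ t p D g f (-vL κ Φ t p D g f) (Bmin' κ Φ t p D g f) + 1))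
      (max (-TrdA κ Φ t p D g f (vL κ Φ t p D g f) (Bmax κ Φ t p D g f)) (-TrdA κ Φ t p D g f (-vL κ Φ t p D g f) (Bmax' κ Φ t p D g f)))))
  linarith

/-- **`hz`**: `z ≤ e`. [folklore] -/
theorem hzA_at (κ : Consts) {V : Type} [DecidableEq V] [Countable V] {G : SimpleGraph V} [G.LocallyFinite] (Φ : PlanarSkeletonFrm G) (t : V) (p : unitInterval) (D : Skelφ.StepI.DataNS V) (g : ℕ) (f : ℕ) : zCA κ Φ t p D g f ≤ (locPrm₁A κ Φ t p D g f).e := Nat.le_add_right _ _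

/-- `e = z + R′`: the schedule's enlargement `e − z` is the kit radius `R′`. [folklore] -/
theorem eA_sub_z (κ : Consts) {V : Type} [DecidableEq V] [Countable V] {G : SimpleGraph V} [G.LocallyFinite] (Φ : PlanarSkeletonFrm G) (t : V) (p : unitInterval) (D : Skelφ.StepI.DataNS V) (g : ℕ) (f : ℕ) : (locPrm₁A κ Φ t p D g f).e - zCA κ Φ t p D g f = R' κ Φ t p D := by
  show eCA κ Φ t p D g f - zCA κ Φ t p D g f = _
  unfold eCA; omega

/-- **`hzP`**: `Pp + z ≤ W`. [folklore] -/
theorem hzPA_at (κ : Consts) {V : Type} [DecidableEq V] [Countable V] {G : SimpleGraph V} [G.LocallyFinite] (Φ : PlanarSkeletonFrm G) (t : V) (p : unitInterval) (D : Skelφ.StepI.DataNS V) (g : ℕ) (f : ℕ) : ((locPrm₁A κ Φ t p D g f).Pp : ℤ) + zCA κ Φ t p D g f ≤ (locPrm₁A κ Φ t p D g f).W := by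
  show ((PpCA κ Φ t p D g f : ℕ) : ℤ) + zCA κ Φ t p D g f ≤ ((WCA κ Φ t p D g f : ℕ) : ℤ)
  have : PpCA κ Φ t p D g f + zCA κ Φ t p D g f ≤ WCA κ Φ t p D g f := by
    unfold WCA; exact le_max_of_le_right (Nat.add_le_add_right (le_max_left _ _) _)
  exact_mod_cast this

/-- **`hzM`**: `Pm + z ≤ W`. [folklore] -/
theorem hzMA_at (κ : Consts) {V : Type} [DecidableEq V] [Countable V] {G : SimpleGraph V} [G.LocallyFinite] (Φ : PlanarSkeletonFrm G) (t : V) (p : unitInterval) (D : Skelφ.StepI.DataNS V) (g : ℕ) (f : ℕ) : ((locPrm₁A κ Φ t p D g f).Pm : ℤ) + zCA κ Φ t p D g f ≤ (locPrm₁A κ Φ t p D g f).W := by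
  show ((PmCA κ Φ t p D g f : ℕ) : ℤ) + zCA κ Φ t p D g f ≤ ((WCA κ Φ t p D g f : ℕ) : ℤ)
  have : PmCA κ Φ t p D g f + zCA κ Φ t p D g f ≤ WCA κ Φ t p D g f := by
    unfold WCA; exact le_max_of_le_right (Nat.add_le_add_right (le_max_right _ _) _)
  exact_mod_cast this

/-- **`h3r₀`**: `3·r₀ ≤ W` (the arrival box of a cell lies in core `0`). [folklore] -/
theorem h3r₀A_at (κ : Consts) {V : Type} [DecidableEq V] [Countable V] {G : SimpleGraph V} [G.LocallyFinite] (Φ : PlanarSkeletonFrm G) (t : V) (p : unitInterval) (D : Skelφ.StepI.DataNS V) (g : ℕ) (f : ℕ) : 3 * (fcellsA κ Φ t p D g f).r 0 ≤ (locPrm₁A κ Φ t p D g f).W := le_max_left _ _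

/-- **`L0 = 3·r₁`**. [folklore] -/
theorem L0A_eq (κ : Consts) {V : Type} [DecidableEq V] [Countable V] {G : SimpleGraph V} [G.LocallyFinite] (Φ : PlanarSkeletonFrm G) (t : V) (p : unitInterval) (D : Skelφ.StepI.DataNS V) (g : ℕ) (f : ℕ) : (locPrm₁A κ Φ t p D g f).L0 = 3 * (fcellsA κ Φ t p D g f).r 1 := rfl

/-- **`hLa`**: `c₁·(|A|·3nℓ) ≤ La·D` under the numeric long clause. [folklore] -/
theorem hLaA_at (κ : Consts) {V : Type} [DecidableEq V] [Countable V] {G : SimpleGraph V} [G.LocallyFinite] (Φ : PlanarSkeletonFrm G) (t : V) (p : unitInterval) (D : Skelφ.StepI.DataNS V) (g : ℕ) (f : ℕ) (hN : EqNumL κ Φ t p D g f) :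
    c1A κ Φ t p D g f * (|Aof κ| * (3 * ((nL κ Φ t p D g f : ℤ) * ℓL κ Φ t p D g f))) ≤ ((locPrm₁A κ Φ t p D g f).La : ℤ) * DdA κ Φ t p D g f := by
  have hD := DdA_pos κ Φ t p D g f hN
  have e8 : |Aof κ| = Aof κ := abs_of_pos (Aof_pos κ).1
  rw [e8]
  set X : ℤ := c1A κ Φ t p D g f * (Aof κ * (3 * ((nL κ Φ t p D g f : ℤ) * ℓL κ Φ t p D g f))) with hX
  have hLa : X / DdA κ Φ t p D g f + 1 ≤ ((locPrm₁A κ Φ t p D g f).La : ℤ) := by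
    show _ ≤ ((LaCA κ Φ t p D g f : ℕ) : ℤ)
    unfold LaCA
    refine le_trans ?_ (Int.self_le_toNat _)
    have : X = c1A κ Φ t p D g f * (Aof κ * (3 * βhi κ Φ t p D g f)) := by rw [hX]; unfold βhi; ring
    rw [this]
    exact le_max_right _ _
  calc X ≤ (X / DdA κ Φ t p D g f + 1) * DdA κ Φ t p D g f := le_ediv_add_one_mul hD
    _ ≤ ((locPrm₁A κ Φ t p D g f).La : ℤ) * DdA κ Φ t p D g f := mul_le_mul_of_nonneg_right hLa hD.le

/-- **`hLb`**: `c₀·(|A|·(|m|·n + |vα|·3nℓ)) ≤ Lb·(n·D)` under the numeric long clause. [folklore] -/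
theorem hLbA_at (κ : Consts) {V : Type} [DecidableEq V] [Countable V] {G : SimpleGraph V} [G.LocallyFinite] (Φ : PlanarSkeletonFrm G) (t : V) (p : unitInterval) (D : Skelφ.StepI.DataNS V) (g : ℕ) (f : ℕ) (hN : EqNumL κ Φ t p D g f) :
    c0A κ Φ t p D g f * (|Aof κ| * (|md κ Φ t p D g f| * nL κ Φ t p D g f + |vL κ Φ t p D g f| * (3 * ((nL κ Φ t p D g f : ℤ) * ℓL κ Φ t p D g f)))) ≤
      ((locPrm₁A κ Φ t p D g f).Lb : ℤ) * ((nL κ Φ t p D g f : ℤ) * DdA κ Φ t p D g f) := by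
  have hD := DdA_pos κ Φ t p D g f hN
  have hn1 : (1 : ℤ) ≤ nL κ Φ t p D g f := by exact_mod_cast (one_le_of_eqNumL κ Φ t p D g f hN).1
  have hnD : 0 < (nL κ Φ t p D g f : ℤ) * DdA κ Φ t p D g f := by positivity
  have e8 : |Aof κ| = Aof κ := abs_of_pos (Aof_pos κ).1
  rw [e8]
  set X : ℤ := c0A κ Φ t p D g f * (Aof κ * (|md κ Φ t p D g f| * nL κ Φ t p D g f + |vL κ Φ t p D g f| * (3 * ((nL κ Φ t p D g f : ℤ) * ℓL κ Φ t p D g f)))) with hX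
  have hLb : X / ((nL κ Φ t p D g f : ℤ) * DdA κ Φ t p D g f) + 1 ≤ ((locPrm₁A κ Φ t p D g f).Lb : ℤ) := by
    show _ ≤ ((LbCA κ Φ t p D g f : ℕ) : ℤ)
    unfold LbCA
    refine le_trans (le_of_eq ?_) (Int.self_le_toNat _)
    rw [hX]; unfold βhi; rfl
  calc X ≤ (X / ((nL κ Φ t p D g f : ℤ) * DdA κ Φ t p D g f) + 1) * ((nL κ Φ t p D g f : ℤ) * DdA κ Φ t p D g f) := le_ediv_add_one_mul hnD
    _ ≤ ((locPrm₁A κ Φ t p D g f).Lb : ℤ) * ((nL κ Φ t p D g f : ℤ) * DdA κ Φ t p D g f) := mul_le_mul_of_nonneg_right hLb hnD.le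

/-! ## §3 The definitional `LocOK` fields and the rounds inequality -/

/-- `aLoA ≤ aHiA` (monotone floor; `c₁ ≥ 0`, `D > 0`). [folklore] -/
theorem aLoA_le_aHiA (κ : Consts) {V : Type} [DecidableEq V] [Countable V] {G : SimpleGraph V} [G.LocallyFinite] (Φ : PlanarSkeletonFrm G) (t : V) (p : unitInterval) (D : Skelφ.StepI.DataNS V) (g : ℕ) (f : ℕ) (hN : EqNumL κ Φ t p D g f) : aLoA κ Φ t p D g f ≤ aHiA κ Φ t p D g f := by
  have hD := DdA_pos κ Φ t p D g f hN
  have hc := (cA_nonneg' κ Φ t p D g f).2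
  unfold aLoA aHiA
  exact Int.ediv_le_ediv hD (mul_le_mul_of_nonneg_left (mul_le_mul_of_nonneg_left (βlo_le_βhi κ Φ t p D g f hN) (Aof_pos κ).1.le) hc)

/-- **`LocOK.hs`**: `sLo ≤ sHi`. [folklore] -/
theorem locOKA_hs (κ : Consts) {V : Type} [DecidableEq V] [Countable V] {G : SimpleGraph V} [G.LocallyFinite] (Φ : PlanarSkeletonFrm G) (t : V) (p : unitInterval) (D : Skelφ.StepI.DataNS V) (g : ℕ) (f : ℕ) (hN : EqNumL κ Φ t p D g f) : (locPrm₁A κ Φ t p D g f).sLo ≤ (locPrm₁A κ Φ t p D g f).sHi := by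
  show sLoCA κ Φ t p D g f ≤ sHiCA κ Φ t p D g f
  unfold sLoCA sHiCA
  linarith [aLoA_le_aHiA κ Φ t p D g f hN]

/-- **`LocOK.hsL`**: `sHi ≤ La`. [folklore] -/
theorem locOKA_hsL (κ : Consts) {V : Type} [DecidableEq V] [Countable V] {G : SimpleGraph V} [G.LocallyFinite] (Φ : PlanarSkeletonFrm G) (t : V) (p : unitInterval) (D : Skelφ.StepI.DataNS V) (g : ℕ) (f : ℕ) : (locPrm₁A κ Φ t p D g f).sHi ≤ (locPrm₁A κ Φ t p D g f).La := by
  show sHiCA κ Φ t p D g f ≤ ((LaCA κ Φ t p D g f : ℕ) : ℤ)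
  unfold LaCA
  exact (le_max_left _ _).trans (Int.self_le_toNat _)

/-- **`LocOK.hPp`** and **`LocOK.hPm`**: both pieces fit in the window. [folklore] -/
theorem locOKA_hP (κ : Consts) {V : Type} [DecidableEq V] [Countable V] {G : SimpleGraph V} [G.LocallyFinite] (Φ : PlanarSkeletonFrm G) (t : V) (p : unitInterval) (D : Skelφ.StepI.DataNS V) (g : ℕ) (f : ℕ) : (locPrm₁A κ Φ t p D g f).Pp ≤ (locPrm₁A κ Φ t p D g f).W ∧ (locPrm₁A κ Φ t p D g f).Pm ≤ (locPrm₁A κ Φ t p D g f).W := by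
  constructor
  · show PpCA κ Φ t p D g f ≤ WCA κ Φ t p D g f
    unfold WCA; exact le_max_of_le_right ((le_max_left _ _).trans (Nat.le_add_right _ _))
  · show PmCA κ Φ t p D g f ≤ WCA κ Φ t p D g f
    unfold WCA; exact le_max_of_le_right ((le_max_right _ _).trans (Nat.le_add_right _ _))

/-- **`LocOK` from its two estimate fields**: given `0 ≤ sLo` and `e ≤ sLo` (part 5b), the record is admissible. [folklore] -/
theorem locOKA_of (κ : Consts) {V : Type} [DecidableEq V] [Countable V] {G : SimpleGraph V} [G.LocallyFinite] (Φ : PlanarSkeletonFrm G) (t : V) (p : unitInterval) (D : Skelφ.StepI.DataNS V) (g : ℕ) (f : ℕ) (hN : EqNumL κ Φ t p D g f) (hs0 : 0 ≤ (locPrm₁A κ Φ t p D g f).sLo) (he : ((locPrm₁A κ Φ t p D g f).e : ℤ) ≤ (locPrm₁A κ Φ t p D g f).sLo) :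
    ChainPara.LocOK (locPrm₁A κ Φ t p D g f) :=
  ⟨hs0, locOKA_hs κ Φ t p D g f hN, locOKA_hsL κ Φ t p D g f, (locOKA_hP κ Φ t p D g f).1, (locOKA_hP κ Φ t p D g f).2, he⟩

/-- **The rounds inequality `hN`**: `L0 ≤ sHi + (N+1)·(sLo − e)` as soon as `e < sLo` (one stride of net progress per round). [folklore] -/
theorem hNA_at (κ : Consts) {V : Type} [DecidableEq V] [Countable V] {G : SimpleGraph V} [G.LocallyFinite] (Φ : PlanarSkeletonFrm G) (t : V) (p : unitInterval) (D : Skelφ.StepI.DataNS V) (g : ℕ) (f : ℕ) (he : ((locPrm₁A κ Φ t p D g f).e : ℤ) < (locPrm₁A κ Φ t p D g f).sLo) :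
    ((locPrm₁A κ Φ t p D g f).L0 : ℤ) ≤ (locPrm₁A κ Φ t p D g f).sHi + (((locPrm₁A κ Φ t p D g f).N : ℕ) + 1 : ℤ) * ((locPrm₁A κ Φ t p D g f).sLo - (locPrm₁A κ Φ t p D g f).e) := by
  show ((L0CA κ Φ t p D g f : ℕ) : ℤ) ≤ sHiCA κ Φ t p D g f + (((NCA κ Φ t p D g f : ℕ) : ℤ) + 1) * (sLoCA κ Φ t p D g f - ((eCA κ Φ t p D g f : ℕ) : ℤ))
  have hd : 0 < sLoCA κ Φ t p D g f - ((eCA κ Φ t p D g f : ℕ) : ℤ) := by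
    have : ((eCA κ Φ t p D g f : ℕ) : ℤ) < sLoCA κ Φ t p D g f := he
    linarith
  set d := sLoCA κ Φ t p D g f - ((eCA κ Φ t p D g f : ℕ) : ℤ) with hdd
  set Y := ((L0CA κ Φ t p D g f : ℕ) : ℤ) - sHiCA κ Φ t p D g f with hY
  have hNC : ((NCA κ Φ t p D g f : ℕ) : ℤ) = ((Y / d).toNat : ℤ) + 1 := by
    unfold NCA; push_cast; rw [← hY, ← hdd]
  rw [hNC]
  -- `Y ≤ (⌊Y/d⌋₊ + 2)·d` : from `Y < (Y/d + 1)·d ≤ (toNat (Y/d) + 1)·d`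
  have h1 : Y ≤ (Y / d + 1) * d := le_ediv_add_one_mul hd
  have h2 : Y / d ≤ ((Y / d).toNat : ℤ) := Int.self_le_toNat _
  nlinarith

end CorrLevel

end NegB

end PlanarSkeletonFrm

end Summit.CriticalPhenomena.PercolationContinuityZ3.Theorems.Transplant

end
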